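import Mathlib
import HarnessLib
import Literature.Analysis.FluidPDE.ClassicalSolution
import Literature.Analysis.FluidPDE.SpaceTimeCalculus
import Literature.Analysis.FluidPDE.WholeSpaceIBP
import Literature.Analysis.FluidPDE.SelfSimilar
import Literature.Analysis.FluidPDE.VectorCalculus
import Summits.NavierStokesRegularity.NavierStokesRegularity.Theorems.ChiralWindowDoorDefs
import Summits.NavierStokesRegularity.NavierStokesRegularity.Theorems.ChiralWindowDoorLocalHelicityLower
import Summits.NavierStokesRegularity.NavierStokesRegularity.Theorems.SelfStrainDoorDefs

/-!
# Door S22 «SelfStrainDoor» (nsreg-p1 ROUND-21; THEOREMS-ONLY landing) — file 2/5: pointwise calculus of the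
# windowed regularised cubic budget

Texts and proofs of nsreg-p1 g18 `P1/r21/S22EndToEnd.lean` 9b9b0bcc57046adf (section `G1`, Stages 1–3 and the slice
lemmas of Stage 4), landed verbatim up to namespacing (lane `ns-pressure-K2-p1` g5, DIRECTOR-NS g9 #60 (1)).  With
`⟨w⟩ = jb w = √(‖w‖²+1)`, `φ₁ = cubeReg`, `ψ = psi a u = (a⟨u⟩)u` (`…Theorems.SelfStrainDoorDefs`):

* Stage 1 — `d/dτ φ₁(γ(τ)) = ⟨γ⟩⟪γ, γ'⟫` (`hasDerivAt_cubeReg_comp`), `D⟨v⟩(x)u = ⟪v x, Dv(x)u⟫/⟨v x⟩`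
  (`hasFDerivAt_jb_comp`, `fderiv_jb_comp_apply`), and the KEY KINEMATIC FACT `divergence_jb_smul`: on a divergence-free,
  self-strain-free slice the field `⟨v⟩v` is divergence-free (`div(⟨v⟩v) = σ(v)/⟨v⟩ = 0`);
* Stage 2 — cutoff facts for `a = bumpSq η 1` (`η` an admissible bump of `…Theorems.ChiralWindowDoorDefs`; `C²`, continuity and
  compact support are the tree's `…ChiralWindowDoorLocalHelicityLower.contDiff_bumpSq/continuous_bumpSq/hasCompactSupport_bumpSq`):
  `∇a = 0` on `B₁` and off `B̄₂`;
* Stage 3 — `hasDerivAt_cubicFunctional`: for a jointly smooth field with Type-I rate and the scale-invariant bound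
  `(‖x‖+√(−t))³‖∂ₜv‖ ≤ K`, the windowed cubic energy `I(t) = ∫ a φ₁(v(t))` is differentiable on `t < 0` with
  `I'(t) = ∫ a⟨v⟩⟪v, ∂ₜv⟫` (dominated differentiation on a time window);
* the slice lemmas of Stage 4 — `Dψ` (`fderiv_psi_apply`), the convexity bound `−⟪∂ₑu, ∂ₑψ⟫ ≤ ‖∇a‖⟨u⟩‖∂ₑu‖‖u‖`
  (`neg_inner_fderiv_psi_le`: the definite terms `a⟨u⟩‖∂ₑu‖²`, `a⟪u,∂ₑu⟫²/⟨u⟩` dropped) and `div ψ = ⟨u⟩∇a·u` on a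
  divergence-free self-strain-free slice (`divergence_psi`).

WHAT THIS IS NOT: not NS regularity; calculus for the residue K2 of a CONDITIONAL door (bears_on LADDER-NS N0, door S22).
-/

noncomputable section

-- the summit and its single sub-problem share the name (CONVENTIONS §1), as in every Theorems file
set_option linter.dupNamespace false

namespace Summit.NavierStokesRegularity.NavierStokesRegularity.Theorems.SelfStrainDoorCubicCalculus

open MeasureTheory Set Function Filter Topology TopologicalSpace Metric InnerProductSpace
open scoped RealInnerProductSpace InnerProductSpace Laplacian ContDiff
open Literature.Analysis Literature.Analysis.FluidPDE
open Summit.NavierStokesRegularity.NavierStokesRegularity.Theorems.ChiralWindowDoorDefs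
open Summit.NavierStokesRegularity.NavierStokesRegularity.Theorems.ChiralWindowDoorLocalHelicityLower
  (contDiff_bumpSq continuous_bumpSq hasCompactSupport_bumpSq)
open Summit.NavierStokesRegularity.NavierStokesRegularity.Theorems.SelfStrainDoorDefs

/-! ## Stage 1: pointwise calculus of `⟨w⟩ = √(‖w‖²+1)` and `φ₁` -/

/-- `d/dτ φ₁(γ(τ)) = ⟨γ⟩ ⟪γ, γ'⟫`. -/
theorem hasDerivAt_cubeReg_comp {γ : ℝ → (EuclideanSpace ℝ (Fin 3))} {γ' : (EuclideanSpace ℝ (Fin 3))} {t : ℝ} (hγ : HasDerivAt γ γ' t) :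
    HasDerivAt (fun τ => cubeReg (γ τ)) (jb (γ t) * ⟪γ t, γ'⟫) t := by
  have hpos : 0 < ⟪γ t, γ t⟫ + 1 := by
    have := real_inner_self_nonneg (x := γ t); linarith
  have h1 : HasDerivAt (fun τ => ⟪γ τ, γ τ⟫ + 1) (⟪γ t, γ'⟫ + ⟪γ', γ t⟫) t :=
    (hγ.inner ℝ hγ).add_const 1
  have h2 := h1.sqrt hpos.ne'
  have h3 := (h2.pow 3).div_const 3
  have hfun : (fun τ => cubeReg (γ τ)) = fun τ => Real.sqrt (⟪γ τ, γ τ⟫ + 1) ^ 3 / 3 := by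
    funext τ; exact cubeReg_eq_inner (γ τ)
  rw [hfun]
  refine h3.congr_deriv ?_
  have hs : Real.sqrt (⟪γ t, γ t⟫ + 1) = jb (γ t) := (jb_eq_inner (γ t)).symm
  rw [hs, real_inner_comm γ']
  have hj := jb_pos (γ t)
  field_simp
  ring

/-- `D(⟨v⟩)(x) u = ⟪v x, Dv(x) u⟫ / ⟨v x⟩` for a differentiable field. -/
theorem hasFDerivAt_jb_comp {v : (EuclideanSpace ℝ (Fin 3)) → (EuclideanSpace ℝ (Fin 3))} {x : (EuclideanSpace ℝ (Fin 3))} (hv : DifferentiableAt ℝ v x) :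
    HasFDerivAt (fun y => jb (v y)) ((jb (v x))⁻¹ • ((innerSL ℝ (v x)).comp (fderiv ℝ v x))) x := by
  have hpos : 0 < ‖v x‖ ^ 2 + 1 := by positivity
  have h1 : HasFDerivAt (fun y => ‖v y‖ ^ 2 + 1) (2 • ((innerSL ℝ (v x)).comp (fderiv ℝ v x))) x :=
    (hv.hasFDerivAt.norm_sq).add_const 1
  have h2 := h1.sqrt hpos.ne'
  refine h2.congr_fderiv ?_
  ext u
  simp only [smul_apply, ContinuousLinearMap.coe_comp, comp_apply, innerSL_apply_apply, smul_eq_mul]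
  rw [jb]
  have hs : 0 < Real.sqrt (‖v x‖ ^ 2 + 1) := Real.sqrt_pos.2 hpos
  field_simp
  ring

/-- `D(⟨v⟩)(x) u` evaluated. -/
theorem fderiv_jb_comp_apply {v : (EuclideanSpace ℝ (Fin 3)) → (EuclideanSpace ℝ (Fin 3))} {x : (EuclideanSpace ℝ (Fin 3))} (hv : DifferentiableAt ℝ v x) (u : (EuclideanSpace ℝ (Fin 3))) :
    fderiv ℝ (fun y => jb (v y)) x u = ⟪v x, fderiv ℝ v x u⟫ / jb (v x) := by
  rw [(hasFDerivAt_jb_comp hv).fderiv]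
  simp only [smul_apply, ContinuousLinearMap.coe_comp, comp_apply, innerSL_apply_apply, smul_eq_mul]
  rw [div_eq_inv_mul]

/-- `⟨v⟩` is differentiable where `v` is. -/
theorem differentiableAt_jb_comp {v : (EuclideanSpace ℝ (Fin 3)) → (EuclideanSpace ℝ (Fin 3))} {x : (EuclideanSpace ℝ (Fin 3))} (hv : DifferentiableAt ℝ v x) :
    DifferentiableAt ℝ (fun y => jb (v y)) x :=
  (hasFDerivAt_jb_comp hv).differentiableAt

/-- `⟨v⟩` is `Cⁿ` for a `Cⁿ` field. -/
theorem contDiff_jb_comp {v : (EuclideanSpace ℝ (Fin 3)) → (EuclideanSpace ℝ (Fin 3))} {n : ℕ∞} (hv : ContDiff ℝ n v) : ContDiff ℝ n (fun y => jb (v y)) := by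
  unfold jb
  exact (((hv.norm_sq ℝ).add contDiff_const).sqrt fun y => by positivity)

/-- **The key kinematic fact.**  On a divergence-free, self-strain-free slice the field `⟨v⟩ v` is divergence-free:
`div(⟨v⟩v) = ⟨v⟩ div v + ⟪v, Dv v⟫/⟨v⟩ = σ(v)/⟨v⟩ = 0`. -/
theorem divergence_jb_smul {v : (EuclideanSpace ℝ (Fin 3)) → (EuclideanSpace ℝ (Fin 3))} {x : (EuclideanSpace ℝ (Fin 3))} (hv : DifferentiableAt ℝ v x)
    (hdiv : VectorCalculus.divergence v x = 0) (hσ : selfStrain v x = 0) :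
    VectorCalculus.divergence (fun y => jb (v y) • v y) x = 0 := by
  rw [Literature.Analysis.FluidPDE.divergence_smul_apply (differentiableAt_jb_comp hv) hv, hdiv, mul_zero, zero_add,
    real_inner_comm, gradient, InnerProductSpace.toDual_symm_apply, fderiv_jb_comp_apply hv]
  rw [selfStrain] at hσ
  simp [hσ]

/-! ## Stage 2: the cutoff and continuity facts -/

variable {η : (EuclideanSpace ℝ (Fin 3)) → ℝ}

/-- `∇a = 0` on the unit ball (`a ≡ 1` there). -/
theorem fderiv_bumpSq_eq_zero_of_norm_lt_one (hη : IsAdmissibleBump η) {x : (EuclideanSpace ℝ (Fin 3))} (hx : ‖x‖ < 1) :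
    fderiv ℝ (bumpSq η 1) x = 0 := by
  have h : bumpSq η 1 =ᶠ[𝓝 x] fun _ => (1 : ℝ) := by
    have hB : ball (0 : (EuclideanSpace ℝ (Fin 3))) 1 ∈ 𝓝 x := isOpen_ball.mem_nhds (by simpa using hx)
    filter_upwards [hB] with y hy
    exact bumpSq_eq_one hη one_pos (le_of_lt (by simpa using hy))
  rw [h.fderiv_eq]
  simp

/-- A derivative vanishes at points off `closedBall 0 2` for a function vanishing there. -/
theorem fderiv_eq_zero_of_two_lt {F : Type*} [NormedAddCommGroup F] [NormedSpace ℝ F] {f : (EuclideanSpace ℝ (Fin 3)) → F}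
    (hf : ∀ y, 2 < ‖y‖ → f y = 0) {x : (EuclideanSpace ℝ (Fin 3))} (hx : 2 < ‖x‖) : fderiv ℝ f x = 0 := by
  have h : f =ᶠ[𝓝 x] fun _ => (0 : F) := by
    have hU : {y : (EuclideanSpace ℝ (Fin 3)) | 2 < ‖y‖} ∈ 𝓝 x := (isOpen_lt continuous_const continuous_norm).mem_nhds hx
    filter_upwards [hU] with y hy using hf y hy
  rw [h.fderiv_eq]
  simp

/-- `∇a = 0` off `B̄₂`. -/
theorem fderiv_bumpSq_eq_zero_of_two_lt_norm (hη : IsAdmissibleBump η) {x : (EuclideanSpace ℝ (Fin 3))} (hx : 2 < ‖x‖) :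
    fderiv ℝ (bumpSq η 1) x = 0 :=
  fderiv_eq_zero_of_two_lt (fun y hy => bumpSq_eq_zero hη one_pos (by linarith)) hx

/-! ## Stage 3: `I(t) = ∫ a φ₁(v(t))` is differentiable with `I'(t) = ∫ a ⟨v⟩⟪v, ∂ₜv⟫` -/

/-- **Differentiability of the windowed cubic energy.**  For a jointly smooth field on `t < 0` with Type-I rate `C` and
the scale-invariant bound `(‖x‖+√(−t))³ ‖∂ₜv(t,x)‖ ≤ K`, and a continuous compactly supported cutoff `a ≥ 0`,
`t ↦ ∫ a φ₁(v(t))` has derivative `∫ a ⟨v(t₀)⟩⟪v(t₀), ∂ₜv(t₀)⟫` at every `t₀ < 0` (dominated differentiation on the time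
window `(t₀ − 1, t₀/2)`). -/
theorem hasDerivAt_cubicFunctional {v : ℝ → (EuclideanSpace ℝ (Fin 3)) → (EuclideanSpace ℝ (Fin 3))} {C K : ℝ} {a : (EuclideanSpace ℝ (Fin 3)) → ℝ}
    (hsm : IsSmoothSpaceTimeOn (Iio (0 : ℝ)) v) (hC : HasTypeITimeDecay C v)
    (hK : ∀ t < (0 : ℝ), ∀ x : (EuclideanSpace ℝ (Fin 3)), (‖x‖ + Real.sqrt (-t)) ^ 3 * ‖deriv (fun τ => v τ x) t‖ ≤ K)
    (ha : Continuous a) (hac : HasCompactSupport a) (ha0 : ∀ x, 0 ≤ a x) {t₀ : ℝ} (ht₀ : t₀ < 0) :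
    HasDerivAt (fun t => ∫ x, a x * cubeReg (v t x))
      (∫ x, a x * (jb (v t₀ x) * ⟪v t₀ x, deriv (fun τ => v τ x) t₀⟫)) t₀ := by
  -- constants
  have hC0 : 0 ≤ C := by
    by_contra hneg
    push Not at hneg
    have h1 := hC t₀ ht₀ 0
    have h2 : C / Real.sqrt (-t₀) < 0 := div_neg_of_neg_of_pos hneg (Real.sqrt_pos.2 (by linarith))
    linarith [norm_nonneg (v t₀ 0)]
  have hK0 : 0 ≤ K := le_trans (by positivity) (hK t₀ ht₀ 0)
  set m : ℝ := Real.sqrt (-(t₀ / 2)) with hm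
  have hm0 : 0 < m := Real.sqrt_pos.2 (by linarith)
  set B : ℝ := (C / m + 1) * ((C / m) * (K / m ^ 3)) with hB
  have hB0 : 0 ≤ B := by positivity
  -- slices and time lines
  have hslice : ∀ t < (0 : ℝ), Continuous (v t) := fun t ht => (hsm.contDiff_slice ht).continuous
  have hline : ∀ t < (0 : ℝ), ∀ x, HasDerivAt (fun τ => v τ x) (deriv (fun τ => v τ x) t) t :=
    fun t ht x => hsm.hasDerivAt_timeLine isOpen_Iio ht x
  -- continuity of `x ↦ ∂ₜv(t₀, x)`
  have hdcont : Continuous fun x => deriv (fun τ => v τ x) t₀ := by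
    have h1 := hsm.continuousOn_timeDerivWithin (uniqueDiffOn_Iio 0)
    have h2 : Continuous fun x : (EuclideanSpace ℝ (Fin 3)) => FluidPDE.timeDerivWithin (Iio (0 : ℝ)) v t₀ x :=
      h1.comp_continuous (continuous_const.prodMk continuous_id) fun x => mk_mem_prod ht₀ (mem_univ x)
    refine h2.congr fun x => ?_
    exact timeDerivWithin_eq_deriv isOpen_Iio ht₀ v x
  -- the neighbourhood
  have hs : Ioo (t₀ - 1) (t₀ / 2) ∈ 𝓝 t₀ := isOpen_Ioo.mem_nhds ⟨by linarith, by linarith⟩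
  have hsneg : ∀ t ∈ Ioo (t₀ - 1) (t₀ / 2), t < 0 := fun t ht => by linarith [ht.2]
  -- pointwise bounds on the window
  have hvb : ∀ t ∈ Ioo (t₀ - 1) (t₀ / 2), ∀ x, ‖v t x‖ ≤ C / m := by
    intro t ht x
    have htn : t < 0 := hsneg t ht
    have hmt : m ≤ Real.sqrt (-t) := Real.sqrt_le_sqrt (by linarith [ht.2])
    exact (hC t htn x).trans (div_le_div_of_nonneg_left hC0 hm0 hmt)
  have hdb : ∀ t ∈ Ioo (t₀ - 1) (t₀ / 2), ∀ x, ‖deriv (fun τ => v τ x) t‖ ≤ K / m ^ 3 := by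
    intro t ht x
    have htn : t < 0 := hsneg t ht
    have hmt : m ≤ Real.sqrt (-t) := Real.sqrt_le_sqrt (by linarith [ht.2])
    have hden : 0 < (‖x‖ + Real.sqrt (-t)) ^ 3 := by
      have := Real.sqrt_pos.2 (show 0 < -t by linarith); positivity
    have h1 : ‖deriv (fun τ => v τ x) t‖ ≤ K / (‖x‖ + Real.sqrt (-t)) ^ 3 := by
      rw [le_div_iff₀ hden, mul_comm]; exact hK t htn x
    have h2 : m ^ 3 ≤ (‖x‖ + Real.sqrt (-t)) ^ 3 :=
      pow_le_pow_left₀ hm0.le (by linarith [norm_nonneg x]) 3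
    exact h1.trans (div_le_div_of_nonneg_left hK0 (by positivity) h2)
  -- dominated differentiation
  have key := hasDerivAt_integral_of_dominated_loc_of_deriv_le (μ := volume) (s := Ioo (t₀ - 1) (t₀ / 2))
    (F := fun t x => a x * cubeReg (v t x))
    (F' := fun t x => a x * (jb (v t x) * ⟪v t x, deriv (fun τ => v τ x) t⟫))
    (bound := fun x => a x * B) (x₀ := t₀) hs ?_ ?_ ?_ ?_ ?_ ?_
  · exact key.2
  · filter_upwards [isOpen_Iio.mem_nhds ht₀] with t ht
    exact (ha.mul (continuous_cubeReg.comp (hslice t ht))).aestronglyMeasurable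
  · exact (ha.mul (continuous_cubeReg.comp (hslice t₀ ht₀))).integrable_of_hasCompactSupport hac.mul_right
  · exact (ha.mul ((continuous_jb.comp (hslice t₀ ht₀)).mul ((hslice t₀ ht₀).inner hdcont))).aestronglyMeasurable
  · refine Eventually.of_forall fun x t ht => ?_
    have h1 := hvb t ht x
    have h2 := hdb t ht x
    have hj : jb (v t x) ≤ C / m + 1 := jb_le_of_norm_le (by positivity) h1
    rw [norm_mul, Real.norm_of_nonneg (ha0 x)]
    refine mul_le_mul_of_nonneg_left ?_ (ha0 x)
    rw [norm_mul, Real.norm_of_nonneg (jb_pos _).le]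
    refine mul_le_mul hj ?_ (norm_nonneg _) (by positivity)
    exact (norm_inner_le_norm _ _).trans (mul_le_mul h1 h2 (norm_nonneg _) (by positivity))
  · exact (ha.mul continuous_const).integrable_of_hasCompactSupport hac.mul_right
  · refine Eventually.of_forall fun x t ht => ?_
    exact (hasDerivAt_cubeReg_comp (hline t (hsneg t ht) x)).const_mul (a x)

/-! ## The slice lemmas of Stage 4: the test field `ψ = (a ⟨u⟩) u` -/

section Slice

variable {u : (EuclideanSpace ℝ (Fin 3)) → (EuclideanSpace ℝ (Fin 3))} {a : (EuclideanSpace ℝ (Fin 3)) → ℝ} {x : (EuclideanSpace ℝ (Fin 3))}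

/-- `D(a⟨u⟩)(x) e = a ⟪u, Du e⟫/⟨u⟩ + ⟨u⟩ Da e`. -/
theorem fderiv_ajb_apply (ha : DifferentiableAt ℝ a x) (hu : DifferentiableAt ℝ u x) (e : (EuclideanSpace ℝ (Fin 3))) :
    fderiv ℝ (fun y => a y * jb (u y)) x e
      = a x * (⟪u x, fderiv ℝ u x e⟫ / jb (u x)) + jb (u x) * fderiv ℝ a x e := by
  rw [fderiv_fun_mul ha (differentiableAt_jb_comp hu)]
  simp only [add_apply, smul_apply, smul_eq_mul]
  rw [fderiv_jb_comp_apply hu]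

/-- `Dψ(x) e = (a⟨u⟩) Du e + (a⟪u, Du e⟫/⟨u⟩ + ⟨u⟩ Da e) u`. -/
theorem fderiv_psi_apply (ha : DifferentiableAt ℝ a x) (hu : DifferentiableAt ℝ u x) (e : (EuclideanSpace ℝ (Fin 3))) :
    fderiv ℝ (psi a u) x e = (a x * jb (u x)) • fderiv ℝ u x e
      + (a x * (⟪u x, fderiv ℝ u x e⟫ / jb (u x)) + jb (u x) * fderiv ℝ a x e) • u x := by
  have h1 : DifferentiableAt ℝ (fun y => a y * jb (u y)) x := ha.mul (differentiableAt_jb_comp hu)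
  have hψ : psi a u = fun y => (a y * jb (u y)) • u y := rfl
  rw [hψ, fderiv_fun_smul h1 hu]
  simp only [add_apply, smul_apply, ContinuousLinearMap.smulRight_apply]
  rw [fderiv_ajb_apply ha hu]

/-- Pointwise convexity bound: `-⟪∂ₑu, ∂ₑψ⟫ ≤ ‖∇a‖ ⟨u⟩ ‖∂ₑu‖ ‖u‖` (the two signed-definite terms
`a⟨u⟩‖∂ₑu‖²` and `a⟪u,∂ₑu⟫²/⟨u⟩` are dropped). -/
theorem neg_inner_fderiv_psi_le (ha : DifferentiableAt ℝ a x) (hu : DifferentiableAt ℝ u x) (ha0 : 0 ≤ a x)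
    {e : (EuclideanSpace ℝ (Fin 3))} (he : ‖e‖ = 1) :
    -⟪fderiv ℝ u x e, fderiv ℝ (psi a u) x e⟫
      ≤ ‖fderiv ℝ a x‖ * (jb (u x) * ‖fderiv ℝ u x e‖ * ‖u x‖) := by
  rw [fderiv_psi_apply ha hu e, inner_add_right, real_inner_smul_right, real_inner_smul_right]
  set ue := fderiv ℝ u x e with hue
  have hj := jb_pos (u x)
  have h1 : 0 ≤ a x * jb (u x) * ⟪ue, ue⟫ := mul_nonneg (mul_nonneg ha0 hj.le) real_inner_self_nonneg
  have h2 : 0 ≤ a x * (⟪u x, ue⟫ / jb (u x)) * ⟪ue, u x⟫ := by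
    rw [real_inner_comm (u x) ue]
    have : a x * (⟪u x, ue⟫ / jb (u x)) * ⟪u x, ue⟫ = a x * ⟪u x, ue⟫ ^ 2 / jb (u x) := by
      field_simp
    rw [this]
    positivity
  have h3 : |fderiv ℝ a x e| ≤ ‖fderiv ℝ a x‖ := by
    have h := (fderiv ℝ a x).le_opNorm e
    rw [he, mul_one, Real.norm_eq_abs] at h
    exact h
  have h4 : |⟪ue, u x⟫| ≤ ‖ue‖ * ‖u x‖ := abs_real_inner_le_norm _ _
  have h5 : -(jb (u x) * fderiv ℝ a x e * ⟪ue, u x⟫) ≤ ‖fderiv ℝ a x‖ * (jb (u x) * ‖ue‖ * ‖u x‖) := by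
    have h6 : |jb (u x) * fderiv ℝ a x e * ⟪ue, u x⟫| ≤ jb (u x) * ‖fderiv ℝ a x‖ * (‖ue‖ * ‖u x‖) := by
      rw [abs_mul, abs_mul, abs_of_pos hj]
      exact mul_le_mul (mul_le_mul_of_nonneg_left h3 hj.le) h4 (abs_nonneg _) (by positivity)
    have h7 := neg_abs_le (jb (u x) * fderiv ℝ a x e * ⟪ue, u x⟫)
    nlinarith
  nlinarith [h1, h2, h5]

/-- On a divergence-free, self-strain-free slice: `div ψ = ⟨u⟩ ∇a·u`. -/
theorem divergence_psi (ha : DifferentiableAt ℝ a x) (hu : DifferentiableAt ℝ u x)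
    (hdiv : VectorCalculus.divergence u x = 0) (hσ : selfStrain u x = 0) :
    VectorCalculus.divergence (psi a u) x = jb (u x) * fderiv ℝ a x (u x) := by
  have h1 : DifferentiableAt ℝ (fun y => a y * jb (u y)) x := ha.mul (differentiableAt_jb_comp hu)
  have hψ : psi a u = fun y => (a y * jb (u y)) • u y := rfl
  rw [hψ, Literature.Analysis.FluidPDE.divergence_smul_apply h1 hu, hdiv, mul_zero, zero_add, real_inner_comm,
    gradient, InnerProductSpace.toDual_symm_apply, fderiv_ajb_apply ha hu]
  rw [selfStrain] at hσ
  rw [hσ]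
  simp

end Slice

end Summit.NavierStokesRegularity.NavierStokesRegularity.Theorems.SelfStrainDoorCubicCalculus

end
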